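import Mathlib.NumberTheory.PrimeCounting
import Literature.NumberTheory.LFunctions.MertensTail
import HarnessLib

/-!
# Mertens' product over the primes `p ≤ x`: `∏_{p ≤ x} (1 - 1/p) ≪ 1 / log x`

Topic `Literature/NumberTheory/Sieve`.  A LIGHT LEAF (imports: Mathlib's prime counting and the
tree's elementary Mertens estimates `MertensTail.lean` only; no definition, no named fact, no
`sorry`) holding the explicit Chebyshev–Mertens upper bound for the Euler product over the
primes `p ≤ x` that the sieve files use as the "`V(z) ≪ 1/log z`" input:

  `∏_{p ≤ x} (1 - 1/p) ≤ e^{6/log 2} · log 2 / log x`   (`x ≥ 2` real).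

It is the restatement over `Nat.primesLE ⌊x⌋₊`, for REAL `x ≥ 2`, of
`Literature.NumberTheory.LFunctions.MertensBound.prod_one_sub_inv_prime_Icc_le` (primes of a real
interval `[P, Q]`).  The natural-number case `x = m` (`Nat.floor_natCast`) is
`Lichtman2020.prod_primesLE_one_sub_inv_le` of `MoebiusShiftedPrimesSieveBound.lean`, whose clients
(`AletheiaZomleferFukshanskyGarcia2020ApplicationsBrunSieveProofs`, `PairLinearFormSieve`, the
Bateman–Horn rough-value transport files of `Summits/Parity`) only need this bound, not the Möbius /
parity material (and its open named facts) that file imports: new clients should import this leaf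
(librarian sweep g34, promote event 3366827, refactor item wi-37777).

Reference: standard (Mertens 1874; e.g. Montgomery–Vaughan, *Multiplicative Number Theory I*,
Thm. 2.7 (e)); the constant `e^{6/log 2}` is the tree's elementary one. [folklore]
-/

open Finset

namespace Literature.NumberTheory.Sieve

/-- **Mertens over the primes `p ≤ x`, real `x ≥ 2`**:
`∏_{p ≤ x} (1 - 1/p) ≤ e^{6/log 2} log 2 / log x` (an explicit form of
`∏_{p ≤ x} (1 - 1/p) ≪ 1/log x`; the primes `p ≤ x` are `Nat.primesLE ⌊x⌋₊`). [folklore] -/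
theorem prod_primesLE_floor_one_sub_one_div_le_log {x : ℝ} (hx : 2 ≤ x) :
    ∏ p ∈ Nat.primesLE ⌊x⌋₊, (1 - 1 / (p : ℝ)) ≤
      Real.exp (6 / Real.log 2) * (Real.log 2 / Real.log x) := by
  have hset : Nat.primesLE ⌊x⌋₊ = (Icc ⌈(2 : ℝ)⌉₊ ⌊x⌋₊).filter Nat.Prime := by
    rw [Nat.ceil_ofNat, Nat.primesLE_eq_filter_Icc_two]
  have hM := Literature.NumberTheory.LFunctions.MertensBound.prod_one_sub_inv_prime_Icc_le
    (le_refl (2 : ℝ)) hx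
  rw [← hset] at hM
  simp_rw [← one_div] at hM
  exact hM

end Literature.NumberTheory.Sieve
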